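import Literature.Analysis.FluidPDE.RusinSverakWeakStabilityFiveLeaves
import Literature.Analysis.FluidPDE.RusinSverakWeakStabilityProofs
import Literature.Analysis.FluidPDE.KatoFarFieldBound
import HarnessLib

/-!
# Rusin–Šverák's weak-limit blow-up and Cor. 4.3 over the five remaining leaves of their cone

Analysis/FluidPDE proof file (no definitions, no named facts) for the named facts
`Literature.Analysis.FluidPDE.rusin_sverak_weak_limit_blowup` (`RusinSverakCompactnessProofs.lean`;
W. Rusin, V. Šverák, *Minimal initial data for potential Navier–Stokes singularities*,
J. Funct. Anal. 260 (2011) 879–891 = arXiv:0911.0500, sentences 2–4 of the proof of **Cor. 4.3**,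
p. 8: a bounded sequence of `Ḣ^{1/2}` blow-up data, normalised by scaling and translation so that
`T_max = 1` with a singular point at `(0, 1)`, has only blow-up data among the weak limits of its
subsequences), `rusin_sverak_minimal_data_compact` and `rusin_sverak_minimal_blowup` (**Cor. 4.3**,
second and first clause, p. 8).

The accepted six-leaves reductions (`rusin_sverak_weak_limit_blowup_of_six_leaves`,
`rusin_sverak_minimal_data_compact_of_six_leaves`, `rusin_sverak_minimal_blowup_of_six_leaves`,
`RusinSverakCompactnessSixLeaves.lean`) derive all three from

1. `localEnergySolution_exists_local_of_memE2` (**F1**; Seregin 2014 Prop. 1.8 =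
   Lemarié-Rieusset 2016 Thm. 14.1), 2. `localEnergySolution_extension_of_memE2` (**F2**;
   Seregin 2014 App. B §B.5 = Lemarié-Rieusset 2016 Thm. 14.8, proof, Steps 1–3),
3. `local_leray_difference_energy_estimate` (Lemarié-Rieusset 2016 Thm. 14.7, proof),
4. `jia_sverak_2013_lemma_2`, 5. `jia_sverak_2013_lemma_8`, 6. `localLeray_limit_isLocalLeraySolution`
   (Jia–Šverák 2013 Lemma 2, Lemma 8, proof of Thm. 1),

through **N** ("the only reason for `T_max(u₀) < ∞` is a singularity", discharged:
`rusin_sverak_singular_point_of_blowup_holds`, `KatoFarFieldBound.lean`) and Cor. 4.2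
(`rusin_sverak_weak_limit_of_singular_points`). Leaf 1 entered only through **E**
`leray_solution_exists_of_memLp_three` (global local Leray solutions for weakly divergence-free
`L³` data). Since then the tree has **proved** the local stage for `L³` data — Kato's mild solution
is a local energy solution in Seregin's class on every interior strip
(`localEnergySolution_exists_local_of_memLp_three`, `LocalEnergyExtension.lean`; Kato 1984 Thm. 1
with Lemarié-Rieusset 2016 Thm. 15.1 (A)) —, recorded **E** from the extension step alone
(`leray_solution_exists_of_memLp_three_of_extension : F2 → E`; Lemarié-Rieusset 2016, Thm. 14.8,
proof, Step 3, started from that stage), and reduced Cor. 4.2 to the five remaining leaves 2–6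
(`rusin_sverak_weak_limit_of_singular_points_of_five_leaves`,
`RusinSverakWeakStabilityFiveLeaves.lean`). This file composes that reduction with **N** and the
accepted glue of `RusinSverakWeakStabilityProofs.lean`, recording the weak-limit blow-up and both
clauses of Cor. 4.3 over the same five leaves, so that `rusin_sverak_weak_limit_blowup_holds`,
`rusin_sverak_minimal_data_compact_holds` and `rusin_sverak_minimal_blowup_holds` are the
corresponding `…_of_five_leaves` applied to the five leaf discharges once they exist (the import
closures of **N** and of the five-leaves Cor. 4.2 are merged here).

## Mathlib / tree search

Tree (all used): `rusin_sverak_weak_limit_of_singular_points_of_five_leaves`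
(`RusinSverakWeakStabilityFiveLeaves.lean`), `rusin_sverak_singular_point_of_blowup_holds`
(`KatoFarFieldBound.lean`), `rusin_sverak_weak_limit_blowup_of_singular_points'`,
`rusin_sverak_minimal_data_compact_of_singular_points'`,
`rusin_sverak_minimal_blowup_of_singular_points'` (`RusinSverakWeakStabilityProofs.lean`).
Nearest existing assemblies: the six-leaves file above and
`rusin_sverak_weak_limit_blowup_of_seven_leaves` (`RusinSverakWeakLimitBlowupSevenLeaves.lean`);
no `rusin_sverak_weak_limit_blowup_of_five_leaves` / `rusin_sverak_minimal_*_of_five_leaves` in the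
tree (`lean search`).

## References

* W. Rusin, V. Šverák, J. Funct. Anal. 260 (2011) 879–891 = arXiv:0911.0500: §4 p. 6 (the
  paragraph after Thm. 4.1), Thm. 4.1, Thm. 4.2, Cor. 4.2, Cor. 4.3 and its proof (pp. 6–8).
  [RusinSverak2011]
* P. G. Lemarié-Rieusset, *The Navier–Stokes Problem in the 21st Century*, CRC Press 2016,
  doi:10.1201/b19556: Thm. 14.7 (p. 514), Thm. 14.8 and its proof (pp. 520–527), Thm. 15.1
  (p. 565). [LemarieRieusset2016]
* H. Jia, V. Šverák, SIAM J. Math. Anal. 45 (2013) 1448–1459 = arXiv:1201.1592: Lemma 2, Cor. 1,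
  Lemma 8, proof of Thm. 1. [JiaSverak2013]
* G. Seregin, *Lecture Notes on Regularity Theory for the Navier–Stokes Equations*, World
  Scientific 2014, App. B, §B.5. [Seregin2014Notes]
* T. Kato, Math. Z. 187 (1984) 471–480, Thm. 1. [Kato1984]
-/

noncomputable section

namespace Literature.Analysis.FluidPDE

/-- **Rusin–Šverák's weak-limit blow-up (proof of Cor. 4.3, sentences 2–4;
`rusin_sverak_weak_limit_blowup`) over the five remaining leaves of its cone**: the extension step
for local energy solutions with `E²` data (2), the difference energy estimate behind weak–strong
uniqueness (3), Jia–Šverák's Lemma 2 (4) and Lemma 8 (5), and the limit step of the local Leray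
limiting procedure (6) — by **N** (discharged: `rusin_sverak_singular_point_of_blowup_holds`) and
Cor. 4.2 over the five leaves (`rusin_sverak_weak_limit_of_singular_points_of_five_leaves`); every
other input of the printed argument (Kato's local theory and its `‖u(t)‖_∞ ≤ C/√t` bound, the local
Leray property of Kato solutions, the local stage of **E**, Prop. 2.2, Lemma 2.1, ε-regularity, the
Sobolev embedding `Ḣ^{1/2} ⊂ L³`, sequential Banach–Alaoglu in `Ḣ^{1/2}`) is a theorem of the tree.
The discharge `rusin_sverak_weak_limit_blowup_holds` is this theorem applied to the five leaf
discharges. [cite: RusinSverak2011, proof of Cor. 4.3, sentences 2–4 (arXiv:0911.0500 p. 8), with Cor. 4.2 and the paragraph after Thm. 4.1 (p. 6)] -/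
theorem rusin_sverak_weak_limit_blowup_of_five_leaves
    (h₂ : localEnergySolution_extension_of_memE2)
    (h₃ : local_leray_difference_energy_estimate)
    (h₄ : jia_sverak_2013_lemma_2) (h₅ : jia_sverak_2013_lemma_8)
    (h₆ : localLeray_limit_isLocalLeraySolution) : rusin_sverak_weak_limit_blowup :=
  rusin_sverak_weak_limit_blowup_of_singular_points' rusin_sverak_singular_point_of_blowup_holds
    (rusin_sverak_weak_limit_of_singular_points_of_five_leaves h₂ h₃ h₄ h₅ h₆)

/-- **Rusin–Šverák, Cor. 4.3, second clause (`rusin_sverak_minimal_data_compact`: the set of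
minimal blow-up data is compact modulo scalings and translations) over the five remaining
leaves**, by **N** and Cor. 4.2 over the five leaves.
[cite: RusinSverak2011, Cor. 4.3 and its proof (arXiv:0911.0500 p. 8)] -/
theorem rusin_sverak_minimal_data_compact_of_five_leaves
    (h₂ : localEnergySolution_extension_of_memE2)
    (h₃ : local_leray_difference_energy_estimate)
    (h₄ : jia_sverak_2013_lemma_2) (h₅ : jia_sverak_2013_lemma_8)
    (h₆ : localLeray_limit_isLocalLeraySolution) : rusin_sverak_minimal_data_compact :=
  rusin_sverak_minimal_data_compact_of_singular_points' rusin_sverak_singular_point_of_blowup_holds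
    (rusin_sverak_weak_limit_of_singular_points_of_five_leaves h₂ h₃ h₄ h₅ h₆)

/-- **Rusin–Šverák, Cor. 4.3, first clause (`rusin_sverak_minimal_blowup`: if some `Ḣ^{1/2}`
datum fails to have a global solution then so does one of minimal norm `ρ_max`) over the five
remaining leaves**, by **N** and Cor. 4.2 over the five leaves.
[cite: RusinSverak2011, Cor. 4.3 (arXiv:0911.0500 p. 8)] -/
theorem rusin_sverak_minimal_blowup_of_five_leaves
    (h₂ : localEnergySolution_extension_of_memE2)
    (h₃ : local_leray_difference_energy_estimate)
    (h₄ : jia_sverak_2013_lemma_2) (h₅ : jia_sverak_2013_lemma_8)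
    (h₆ : localLeray_limit_isLocalLeraySolution) : rusin_sverak_minimal_blowup :=
  rusin_sverak_minimal_blowup_of_singular_points' rusin_sverak_singular_point_of_blowup_holds
    (rusin_sverak_weak_limit_of_singular_points_of_five_leaves h₂ h₃ h₄ h₅ h₆)

end Literature.Analysis.FluidPDE

end
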